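import Summits.QuantumAdvantage.QuantumAdvantage.Theorems.CharDialFutureReadA

/-! # CharDialFutureRead — part 2/2 (mechanical split for landing of `CharDialFutureRead`; content verbatim; scopes re-opened with their variables) -/


namespace Summit.QuantumAdvantage.AdviceFreeQNC0
open Finset AffBells22

namespace JLinPeel
open CounterLaw

section Generic
variable {p n : ℕ} (A : Fin (n + 1) → ZMod p → Bool) (B : Fin (n + 1) → Fin n → ZMod p → Bool)
  (rp : Fin (n + 1) → Option (Fin n)) (φ : Fin (n + 1) → (Fin n → Bool) → ZMod p)
  (W : Finset (Fin n)) (b : Fin n → Bool)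

/-- the COUNTER PART on the subcube: `A_g(φ) ⊕ (b_j ∧ B_g(φ))` for a frozen read `j ∈ W`, `A_g(φ)` otherwise. -/
def yC : Fin (n + 1) → (Fin n → Bool) → Bool := fun g v =>
  match rp g with
  | some j => if j ∈ W then xor (A g (φ g v)) (b j && B g j (φ g v)) else A g (φ g v)
  | none => A g (φ g v)

/-- the FREE-READ PART: `v_j ∧ B_g(φ)` for a free read `j ∉ W`, nothing otherwise. -/
def yF : Fin (n + 1) → (Fin n → Bool) → Bool := fun g v =>
  match rp g with
  | some j => if j ∈ W then false else (v j && B g j (φ g v))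
  | none => false

/-- the reference merged input (all free bits `false`): the frozen prefix data of a promising cut is read off it. -/
def ref : Fin n → Bool := subcubeMerge W b fun _ => false

/-- the `B`-bit of cut `g` reading `j`, at the reference form value. -/
def βr (g : Fin (n + 1)) (j : Fin n) : Bool := B g j (φ g (ref W b))

/-- the number of cuts reading position `i` with `B`-bit set and reference label `≠ s`. -/
noncomputable def Ncnt (i : Fin n) (s : ZMod 3) : ℕ :=
  (univ.filter fun g : Fin (n + 1) => rp g = some i ∧ βr B φ W b g i = true ∧ labN (ref W b) g.val ≠ s).card

/-- **the schedule** `τ_i = ⊕_{g reads i, β_g} e(ℓ_g)` on free positions (stored as its two coordinates = parities), `0` on `W`. -/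
noncomputable def τF : Fin n → Bool × Bool := fun i =>
  if i ∈ W then (false, false) else (decide (Ncnt B rp φ W b i 0 % 2 = 1), decide (Ncnt B rp φ W b i 1 % 2 = 1))

/-- the schedule evaluated: `ev τ_i s` is the parity of `Ncnt i s` (the third coordinate is the XOR of the first two). -/
theorem ev_τF {i : Fin n} (hi : i ∉ W) (s : ZMod 3) :
    ev (τF B rp φ W b i) s = decide (Ncnt B rp φ W b i s % 2 = 1) := by
  unfold τF
  rw [if_neg hi]
  unfold ev
  by_cases h0 : s = 0
  · subst h0; simp
  by_cases h1 : s = 1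
  · subst h1; simp
  have h2 : s = 2 := by
    revert s; decide
  subst h2
  rw [if_neg h0, if_neg h1]
  -- `Ncnt i 0 + Ncnt i 1 ≡ Ncnt i 2 (mod 2)`
  set G := univ.filter fun g : Fin (n + 1) => rp g = some i ∧ βr B φ W b g i = true with hG
  have hN : ∀ s : ZMod 3, Ncnt B rp φ W b i s = ∑ g ∈ G, if labN (ref W b) g.val ≠ s then 1 else 0 := by
    intro s
    unfold Ncnt
    rw [card_eq_sum_ones, sum_filter, sum_filter]
    refine sum_congr rfl fun g _ => ?_
    by_cases hA : rp g = some i ∧ βr B φ W b g i = true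
    · by_cases hB : labN (ref W b) g.val ≠ s
      · rw [if_pos ⟨hA.1, hA.2, hB⟩, if_pos hA, if_pos hB]
      · rw [if_neg (fun h => hB h.2.2), if_pos hA, if_neg hB]
    · rw [if_neg (fun h => hA ⟨h.1, h.2.1⟩), if_neg hA]
  have hsum : Ncnt B rp φ W b i 0 + Ncnt B rp φ W b i 1
      = Ncnt B rp φ W b i 2 + 2 * ∑ g ∈ G, if labN (ref W b) g.val = 2 then 1 else 0 := by
    rw [hN 0, hN 1, hN 2, mul_sum, ← sum_add_distrib, ← sum_add_distrib]
    refine sum_congr rfl fun g _ => ?_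
    generalize labN (ref W b) g.val = ℓ
    revert ℓ; decide
  have hpar : (Ncnt B rp φ W b i 0 + Ncnt B rp φ W b i 1) % 2 = Ncnt B rp φ W b i 2 % 2 := by rw [hsum]; omega
  rcases Nat.mod_two_eq_zero_or_one (Ncnt B rp φ W b i 0) with a0 | a0 <;>
  rcases Nat.mod_two_eq_zero_or_one (Ncnt B rp φ W b i 1) with a1 | a1 <;>
  · rw [Nat.add_mod, a0, a1] at hpar
    simp [a0, a1, ← hpar]

/-- on merged inputs the strategy is the counter part ⊕ the free-read part. -/
theorem str_merge (g : Fin (n + 1)) (u : Fin n → Bool) :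
    str A B rp φ g (subcubeMerge W b u)
      = xor (yC A B rp φ W b g (subcubeMerge W b u)) (yF B rp φ W g (subcubeMerge W b u)) := by
  unfold str yC yF
  cases hr : rp g with
  | none => simp
  | some j =>
    simp only []
    by_cases hj : j ∈ W
    · rw [if_pos hj, if_pos hj, Bool.xor_false, merge_apply_frozen W b _ hj]
    · rw [if_neg hj, if_neg hj]

variable (hφ : ∀ g : Fin (n + 1), ∀ u v : Fin n → Bool, wtPrefix u g.val % p = wtPrefix v g.val % p → φ g u = φ g v)
  (hfut : ∀ g j, rp g = some j → j ∉ W → ∀ i : Fin n, i.val < g.val → i ∈ W)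
include hφ

/-- the counter part IS a counter strategy mod `p`. -/
theorem yC_counter (g : Fin (n + 1)) (u v : Fin n → Bool) (huv : wtPrefix u g.val % p = wtPrefix v g.val % p) :
    yC A B rp φ W b g u = yC A B rp φ W b g v := by
  unfold yC
  rw [hφ g u v huv]

omit hφ in
include hfut in
/-- a cut reading a free position sees a FROZEN prefix: its prefix weight is that of the reference input. -/
theorem wtPrefix_eq_ref {g : Fin (n + 1)} {j : Fin n} (hr : rp g = some j) (hj : j ∉ W) (u : Fin n → Bool) :
    wtPrefix (subcubeMerge W b u) g.val = wtPrefix (ref W b) g.val := by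
  have hfro : ∀ i : Fin n, i.val < g.val → i ∈ W := hfut g j hr hj
  refine wtPrefix_congr fun i hi => ?_
  unfold ref
  rw [merge_apply_frozen W b _ (hfro i hi), merge_apply_frozen W b _ (hfro i hi)]

include hfut

/-- hence its form value, label and `B`-bit are constants of the subcube. -/
theorem yF_eq {g : Fin (n + 1)} {j : Fin n} (hr : rp g = some j) (hj : j ∉ W) (u : Fin n → Bool) :
    yF B rp φ W g (subcubeMerge W b u) = (u j && βr B φ W b g j) := by
  unfold yF βr
  rw [hr]
  simp only []
  rw [if_neg hj, merge_apply_free W b u hj,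
    hφ g (subcubeMerge W b u) (ref W b) (by rw [wtPrefix_eq_ref rp W b hfut hr hj u])]

omit hφ in
/-- CharDialFutureRead helper `labN_eq_ref` (decomp-qadv land package; see the module docstring). -/
theorem labN_eq_ref {g : Fin (n + 1)} {j : Fin n} (hr : rp g = some j) (hj : j ∉ W) (u : Fin n → Bool) :
    labN (subcubeMerge W b u) g.val = labN (ref W b) g.val := by
  unfold labN
  rw [wtPrefix_eq_ref rp W b hfut hr hj u]

/-- **the double count**: the free-read win parity = the parity of the kept promises seen at `s`. -/
theorem card_yF_mod_two (u : Fin n → Bool) (s : ZMod 3) :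
    (univ.filter fun g : Fin (n + 1) =>
        yF B rp φ W g (subcubeMerge W b u) = true ∧ labN (subcubeMerge W b u) g.val ≠ s).card % 2
      = (univ.filter fun i : Fin n =>
          i.val < n ∧ subcubeMerge W b u i = true ∧ ev (τF B rp φ W b i) s = true).card % 2 := by
  classical
  -- fibre the winning free-read cuts by their read position
  set S := univ.filter fun g : Fin (n + 1) =>
      yF B rp φ W g (subcubeMerge W b u) = true ∧ labN (subcubeMerge W b u) g.val ≠ s with hS
  have hmem : ∀ g ∈ S, ∃ j, rp g = some j ∧ j ∉ W ∧ u j = true ∧ βr B φ W b g j = true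
      ∧ labN (ref W b) g.val ≠ s := by
    intro g hg
    rw [hS, mem_filter] at hg
    obtain ⟨_, hy, hl⟩ := hg
    cases hr : rp g with
    | none => unfold yF at hy; rw [hr] at hy; exact absurd hy (by simp)
    | some j =>
      by_cases hj : j ∈ W
      · unfold yF at hy; rw [hr] at hy; simp only [hj, if_true] at hy; exact absurd hy (by simp)
      · rw [yF_eq B rp φ W b hφ hfut hr hj u, Bool.and_eq_true] at hy
        rw [labN_eq_ref rp W b hfut hr hj u] at hl
        exact ⟨j, rfl, hj, hy.1, hy.2, hl⟩
  set T := univ.filter fun i : Fin n => i ∉ W ∧ u i = true with hT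
  have hmap : ∀ g ∈ S, rp g ∈ T.map Function.Embedding.some := by
    intro g hg
    obtain ⟨j, hr, hj, hu, -, -⟩ := hmem g hg
    rw [hr, mem_map]
    exact ⟨j, by rw [hT, mem_filter]; exact ⟨mem_univ _, hj, hu⟩, rfl⟩
  have hcount : S.card = ∑ i ∈ T, Ncnt B rp φ W b i s := by
    rw [card_eq_sum_card_fiberwise hmap, sum_map]
    refine sum_congr rfl fun i hi => ?_
    rw [hT, mem_filter] at hi
    obtain ⟨_, hiW, hui⟩ := hi
    unfold Ncnt
    congr 1
    ext g
    simp only [mem_filter, mem_univ, true_and, Function.Embedding.some_apply]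
    constructor
    · rintro ⟨hg, hgi⟩
      obtain ⟨j, hr, hj, hu, hβ, hl⟩ := hmem g hg
      rw [hr, Option.some.injEq] at hgi
      subst hgi
      exact ⟨hr, hβ, hl⟩
    · rintro ⟨hr, hβ, hl⟩
      refine ⟨?_, hr⟩
      rw [hS, mem_filter]
      refine ⟨mem_univ _, ?_, ?_⟩
      · rw [yF_eq B rp φ W b hφ hfut hr hiW u, hui, hβ]; rfl
      · rw [labN_eq_ref rp W b hfut hr hiW u]; exact hl
  -- the right-hand side counts the free `1`-positions with an odd `Ncnt`
  have hR : (univ.filter fun i : Fin n => i.val < n ∧ subcubeMerge W b u i = true ∧ ev (τF B rp φ W b i) s = true)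
      = T.filter fun i => Ncnt B rp φ W b i s % 2 = 1 := by
    ext i
    rw [hT, mem_filter, mem_filter, mem_filter]
    simp only [mem_univ, true_and, i.isLt]
    by_cases hiW : i ∈ W
    · have : ev (τF B rp φ W b i) s = false := by unfold τF; rw [if_pos hiW, ev_zero]
      simp [this, hiW]
    · rw [ev_τF B rp φ W b hiW, merge_apply_free W b u hiW]
      simp [hiW]
  rw [hcount, hR]
  exact sum_mod_two_eq_card_odd T _

/-- **LOSE on the subcube ⟺ the scheduled process of part 24 ends in `L_{(n−c,0)}`.** -/
theorem lose_iff_memT (c : ℕ) (u : Fin n → Bool) :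
    ringWinU c (str A B rp φ) (subcubeMerge W b u) = false ↔
      mem ((((n : ℕ) : ZMod 3) - c), none)
        (XTp p (yC A B rp φ W b) (τF B rp φ W b) (subcubeMerge W b u) n).1
        (XTp p (yC A B rp φ W b) (τF B rp φ W b) (subcubeMerge W b u) n).2.1 = true := by
  set u' := subcubeMerge W b u with hu'
  set s : ZMod 3 := (((n : ℕ) : ZMod 3) - c) - labN u' n with hs
  -- WIN = WIN(counter part) ⊕ WIN(free-read part)
  have h1 : ringWinU c (str A B rp φ) u'
      = xor (ringWinU c (yC A B rp φ W b) u') (ringWinU c (yF B rp φ W) u') := by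
    rw [← ringWinU_xor]
    exact Summit.QuantumAdvantage.AdviceFreeQNC0.LinForms.ringWinU_congr c fun g => str_merge A B rp φ W b g u
  -- the counter part through its register
  have h2 : ringWinU c (yC A B rp φ W b) u' = ev (regN p (yC A B rp φ W b) u' (n + 1)) s :=
    ringWinU_eq_ev p (yC A B rp φ W b) (fun g v w h => yC_counter A B rp φ W b hφ g v w h) c u'
  -- the free-read part through the cumulative schedule
  have h3 : ringWinU c (yF B rp φ W) u' = ev (cum (τF B rp φ W b) u' n) s := by
    rw [ringWinU_eq_lab, ev_cum, card_yF_mod_two B rp φ W b hφ hfut u s]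
  have hX1 : (XTp p (yC A B rp φ W b) (τF B rp φ W b) u' n).1
      = bx (regN p (yC A B rp φ W b) u' (n + 1)) (cum (τF B rp φ W b) u' n) := by
    show regTp p (yC A B rp φ W b) (τF B rp φ W b) u' n = _
    exact regTp_eq_bx p _ _ u' n
  have hX2 : (XTp p (yC A B rp φ W b) (τF B rp φ W b) u' n).2.1 = labN u' n := rfl
  rw [hX1, hX2, h1, h2, h3, ← ev_bx]
  simp only [mem, patVal, ← hs]
  cases ev (bx (regN p (yC A B rp φ W b) u' (n + 1)) (cum (τF B rp φ W b) u' n)) s <;> simp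

/-- the WIN set on the subcube IS the complement of the process's `L`-event (as finsets). -/
theorem filter_win_eq (c : ℕ) :
    (univ.filter fun u : Fin n → Bool => ringWinU c (str A B rp φ) (subcubeMerge W b u) = true)
      = univ.filter fun u : Fin n → Bool =>
          mem ((((n : ℕ) : ZMod 3) - c), none)
            (XTp p (yC A B rp φ W b) (τF B rp φ W b) (subcubeMerge W b u) n).1
            (XTp p (yC A B rp φ W b) (τF B rp φ W b) (subcubeMerge W b u) n).2.1 = false := by
  ext u
  simp only [mem_filter, mem_univ, true_and]
  have h := lose_iff_memT A B rp φ W b hφ hfut (p := p) c u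
  constructor
  · intro hw
    cases hm : mem ((((n : ℕ) : ZMod 3) - c), none)
        (XTp p (yC A B rp φ W b) (τF B rp φ W b) (subcubeMerge W b u) n).1
        (XTp p (yC A B rp φ W b) (τF B rp φ W b) (subcubeMerge W b u) n).2.1
    · rfl
    · rw [h.2 hm] at hw; exact absurd hw (by simp)
  · intro hm
    cases hw : ringWinU c (str A B rp φ) (subcubeMerge W b u)
    · rw [h.1 hw] at hm; exact absurd hm (by simp)
    · rfl

/-- **E3 on a subcube, generic** (`3 ∤ p`, `0 < p`): a one-read counter source whose free reads are promised before the free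
segment wins on at most `(2/3 + 4p√(12p/(n − |W| + 1)))·2ⁿ` merged inputs. -/
theorem winSubcube_le (h3 : ¬ 3 ∣ p) (hp : 0 < p) (c : ℕ) :
    ((univ.filter fun u : Fin n → Bool => ringWinU c (str A B rp φ) (subcubeMerge W b u) = true).card : ℝ)
      ≤ (2 / 3 + 4 * p * Real.sqrt (12 * p / ((n - W.card : ℕ) + 1))) * (2 : ℝ) ^ n := by
  rw [filter_win_eq A B rp φ W b hφ hfut c]
  exact schedSubcube_sharp p h3 hp (yC A B rp φ W b) (τF B rp φ W b) W b _

end Generic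

/-! ## §5 Prefix one-read `JLinData` are one-read counter sources -/

section Prefix

variable {p n : ℕ} (D : JLinData p n)
  (hpre : ∀ g, ∃ t : ZMod p, D.a g = fun i => if i.val < g.val then t else 0)
  (hJ1 : ∀ g, (D.J g).card ≤ 1)
include hJ1

/-- a one-read `JLinData` plays the strategy of the source `(tabA, tabB, readPos, form)`. -/
theorem strat_eq_str (g : Fin (n + 1)) (v : Fin n → Bool) :
    D.strat g v = str (tabA D) (tabB D) (readPos D) D.form g v := by
  unfold JLinData.strat str
  cases hr : readPos D g with
  | none =>
    simp only [Bool.xor_false]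
    exact h_of_junta_empty D (junta_of_readPos_none D hr) _ _
  | some j =>
    simp only []
    exact h_of_junta_single D (junta_of_readPos_some D hJ1 hr) _ _

/-- CharDialFutureRead helper `strat_eq_str'` (decomp-qadv land package; see the module docstring). -/
theorem strat_eq_str' : D.strat = str (tabA D) (tabB D) (readPos D) D.form :=
  funext fun g => funext fun v => strat_eq_str D hJ1 g v

omit hJ1 in
include hpre in
/-- prefix forms are counter statistics mod `p`. -/
theorem form_counter (g : Fin (n + 1)) (u v : Fin n → Bool) (huv : wtPrefix u g.val % p = wtPrefix v g.val % p) :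
    D.form g u = D.form g v := by
  obtain ⟨t, ht⟩ := hpre g
  rw [form_prefix D ht, form_prefix D ht, (ZMod.natCast_eq_natCast_iff' _ _ _).2 huv]

include hpre

/-- **E3 on a subcube** for prefix one-read data. -/
theorem futureReadSubcube_le (W : Finset (Fin n)) (b : Fin n → Bool) (h3 : ¬ 3 ∣ p) (hp : 0 < p)
    (hfut : ∀ g, ∀ j ∈ D.J g, j ∉ W → ∀ i : Fin n, i.val < g.val → i ∈ W) (c : ℕ) :
    ((univ.filter fun u : Fin n → Bool => ringWinU c D.strat (subcubeMerge W b u) = true).card : ℝ)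
      ≤ (2 / 3 + 4 * p * Real.sqrt (12 * p / ((n - W.card : ℕ) + 1))) * (2 : ℝ) ^ n := by
  rw [strat_eq_str' D hJ1]
  refine winSubcube_le _ _ _ _ W b (form_counter D hpre) (fun g j hr hj => ?_) h3 hp c
  exact hfut g j (by rw [junta_of_readPos_some D hJ1 hr]; exact mem_singleton_self j) hj

end Prefix

/-! ## §5 The theorem: `PrefixFutureReadHard p` for every prime `p ≠ 3` -/

section Main

variable {p : ℕ} [hp : Fact p.Prime]

/-- **E3, explicit constants** (prime `p ≠ 3`; every `n`, every charge): a one-read junta ⊕ prefix-counter strategy with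
a time `m` and `6912·p³` positions `j ≥ m` each read only by cuts `g ≤ m` wins on at most `(5/6)·2ⁿ` inputs. -/
theorem prefixFutureRead_hard_explicit (hp3 : p ≠ 3) (n c : ℕ) (D : JLinData p n)
    (hpre : ∀ g, ∃ t : ZMod p, D.a g = fun i => if i.val < g.val then t else 0)
    (hJ1 : ∀ g, (D.J g).card ≤ 1)
    (hF : ∃ m : ℕ, 6912 * p ^ 3 ≤ (univ.filter fun j : Fin n => m ≤ j.val ∧ ∀ g, j ∈ D.J g → g.val ≤ m).card) :
    (winCount c D.strat : ℝ) ≤ 5 / 6 * (2 : ℝ) ^ n := by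
  classical
  have h3 : ¬ 3 ∣ p := fun h => hp3 ((Nat.prime_dvd_prime_iff_eq Nat.prime_three hp.out).mp h).symm
  have hp0 : 0 < p := hp.out.pos
  obtain ⟨m, hm⟩ := hF
  set F : Finset (Fin n) := univ.filter fun j : Fin n => m ≤ j.val ∧ ∀ g, j ∈ D.J g → g.val ≤ m with hFdef
  set W : Finset (Fin n) := univ.filter fun j : Fin n => ¬ (m ≤ j.val ∧ ∀ g, j ∈ D.J g → g.val ≤ m) with hW
  have hFW : F.card + W.card = n := by
    have := Finset.card_filter_add_card_filter_not (s := (univ : Finset (Fin n)))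
      (fun j : Fin n => m ≤ j.val ∧ ∀ g, j ∈ D.J g → g.val ≤ m)
    simpa [hFdef, hW] using this
  have hnW : n - W.card = F.card := by omega
  -- the E3 hypothesis on the subcubes over `W`
  have hfut : ∀ g, ∀ j ∈ D.J g, j ∉ W → ∀ i : Fin n, i.val < g.val → i ∈ W := by
    intro g j hj hjW i hi
    have hjF : m ≤ j.val ∧ ∀ g, j ∈ D.J g → g.val ≤ m := by
      by_contra hc; exact hjW (mem_filter.2 ⟨mem_univ _, hc⟩)
    have hgm : g.val ≤ m := hjF.2 g hj
    exact mem_filter.2 ⟨mem_univ _, fun h => by omega⟩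
  have hb : ∀ b : Fin n → Bool,
      ((univ.filter fun u : Fin n → Bool => ringWinU c D.strat (subcubeMerge W b u) = true).card : ℝ)
        ≤ 5 / 6 * (2 : ℝ) ^ n := by
    intro b
    refine (futureReadSubcube_le D hpre hJ1 W b h3 hp0 hfut c).trans (mul_le_mul_of_nonneg_right ?_ (by positivity))
    rw [hnW]
    have hp1 : (1 : ℝ) ≤ p := by exact_mod_cast hp0
    have hn' : (6912 : ℝ) * p ^ 3 ≤ (F.card : ℝ) + 1 := by
      have : ((6912 * p ^ 3 : ℕ) : ℝ) ≤ (F.card : ℝ) := by exact_mod_cast hm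
      push_cast at this; linarith
    have hpos : (0 : ℝ) < (F.card : ℝ) + 1 := by positivity
    have hfrac : (12 : ℝ) * p / ((F.card : ℝ) + 1) ≤ (1 / (24 * p)) ^ 2 := by
      rw [div_le_iff₀ hpos]
      have e : (1 / (24 * (p : ℝ))) ^ 2 * (6912 * p ^ 3) = 12 * p := by field_simp; ring
      calc (12 : ℝ) * p = (1 / (24 * (p : ℝ))) ^ 2 * (6912 * p ^ 3) := e.symm
        _ ≤ (1 / (24 * (p : ℝ))) ^ 2 * ((F.card : ℝ) + 1) := by
            apply mul_le_mul_of_nonneg_left hn'; positivity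
    have hsq : Real.sqrt (12 * p / ((F.card : ℝ) + 1)) ≤ 1 / (24 * p) := by
      calc Real.sqrt (12 * p / ((F.card : ℝ) + 1)) ≤ Real.sqrt ((1 / (24 * p)) ^ 2) := Real.sqrt_le_sqrt hfrac
        _ = 1 / (24 * p) := Real.sqrt_sq (by positivity)
    have : 4 * (p : ℝ) * Real.sqrt (12 * p / ((F.card : ℝ) + 1)) ≤ 4 * p * (1 / (24 * p)) :=
      mul_le_mul_of_nonneg_left hsq (by positivity)
    have h16 : 4 * (p : ℝ) * (1 / (24 * p)) = 1 / 6 := by field_simp; ring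
    linarith
  -- fibre counting
  have hsum := sum_card_subcube W (fun u : Fin n → Bool => ringWinU c D.strat u = true)
  have h2n : (0 : ℝ) < 2 ^ n := by positivity
  have hR : (2 : ℝ) ^ n * (winCount c D.strat : ℝ) ≤ (2 : ℝ) ^ n * (5 / 6 * 2 ^ n) := by
    have e1 : (2 : ℝ) ^ n * (winCount c D.strat : ℝ) =
        ∑ b : Fin n → Bool,
          ((univ.filter fun u : Fin n → Bool => ringWinU c D.strat (subcubeMerge W b u) = true).card : ℝ) := by
      unfold winCount; rw [← Nat.cast_sum, hsum]; push_cast; ring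
    rw [e1]
    calc _ ≤ ∑ b : Fin n → Bool, 5 / 6 * (2 : ℝ) ^ n := sum_le_sum fun b _ => hb b
      _ = (2 : ℝ) ^ n * (5 / 6 * 2 ^ n) := by
          rw [sum_const, card_univ, Fintype.card_fun, Fintype.card_bool, Fintype.card_fin]; simp
  exact le_of_mul_le_mul_left hR h2n


/-- **E3 — prefix counters with FUTURE one-reads promised before the free segment lose** (prime `p ≠ 3`; `θ = 5/6`,
`m₀ = 6912·p³`; every `n`, every charge): the body of `JLinPeel.PrefixFutureReadHard p`. -/
theorem prefixFutureRead_hard_unif (hp3 : p ≠ 3) :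
    ∃ θ : ℝ, θ < 1 ∧ ∃ m₀ : ℕ, ∀ (n c : ℕ) (D : JLinData p n),
      (∀ g, ∃ t : ZMod p, D.a g = fun i => if i.val < g.val then t else 0) →
      (∀ g, (D.J g).card ≤ 1) →
      (∀ g, ∀ j ∈ D.J g, g.val ≤ j.val) →
      (∃ m : ℕ, m₀ ≤ (univ.filter fun j : Fin n => m ≤ j.val ∧ ∀ g, j ∈ D.J g → g.val ≤ m).card) →
      (winCount c D.strat : ℝ) ≤ θ * (2 : ℝ) ^ n :=
  ⟨5 / 6, by norm_num, 6912 * p ^ 3, fun n c D hpre hJ1 _ hF => prefixFutureRead_hard_explicit hp3 n c D hpre hJ1 hF⟩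

end Main

end JLinPeel

end Summit.QuantumAdvantage.AdviceFreeQNC0
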